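import Summits.QuantumFields.YangMills.Theorems.BalabanUVNodesN12AtTheta13OfThm1CCMOfStepR
import Summits.QuantumFields.YangMills.Theorems.BalabanUVNodesK0ROfStepTokensRCube
import Literature.MathematicalPhysics.QuantumFieldTheory.Balaban1983to89.Node00.Record13SepCoPInhabitedOfThm1CCMWGaugeR

/-!
# BalabanUVNodes ∕ N12 — THE K0⁷ → K1⁷ JUNCTION AT THE WINDOW-EDITION WITNESS: the K1⁷ v5 rung body (N12 and N13 resolved), its N12 restriction and its ΛΩχZ-pinned form at the
# door-cured `θ₁₅ᶜᶜᴹ(3;γ)(B₃, B₉·B₃, a₀, min a₁ (a₀''∕B₃)) = theta13OfThm1CCMW F 2 3 γ ε₀ ε₂₉ B₃ B₃' a₀ a₁'` (dag-n21-c A1ʷ) with the K-side input = EXACTLY the V16 stub letters —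
# stub 1 ([15] Prop. 8's top step), stub 2 ([6] Prop. 6 at NODE 00's member), stub 3ʷ's conclusion (NODE O's window `γ ∈ ]0,½]` and the γ-box of β at the witness) — and `4 ≤ F.m`
# (Track A, DAG node N12 = [B15, Balaban1989LargeFieldI] CMP **122** (1989) 175–202; cluster K1 — K1⁷ `StabilityBAtRecordR13SepCoPH` = stmt-QuantumFields-20542, helper; seat
# `pub-ymgap-dag-n12-d` g14 (R134 s2 «knit at the record»), 2026-08-27; count-neutral, CONDITIONAL, NOT a discharge)

HONEST FRAMING.  Count-neutral kernel COMPOSITION BY NAME — the window twin of 12Z′ `…N12AtTheta13OfThm1CCMCubeOfStubs` after dag-n21-c g12's LOCATED-WINDOW (bus l.22290: V15 stub 3′'s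
β-box at `γ = ½` is K0a's displayed default hard-coded, not print's «γ sufficiently small» — [I] Thm 1 p.259, §1 p.264; [II] p.355; repair = the window edition `theta13OfThm1CCMW F N j γ …`
(A1ʷ `Node00.Record13NumericsOfThm1CCMW`: `{stage12NumericsOfThm1CCM … with γ := γ}`; at `γ = ½` it IS `θ₁₅ᶜᶜᴹ(j)`, `rfl`) with stub 3ʷ «∃ γ ε₀ ε₂₉ b β′, 0 < γ ≤ ½ ∧ … ∧ BetaLowerH b γ β ∧
BetaUpperH β′ γ β ∧ β′·γ² ≤ ¾», `β = betaOfRecord₁₃ F 2 θ₁₅ᶜᶜᴹ(3)`; plan g77 WINDOW-WORD l.22324 ∕ SIGNFREE-WORD l.22622: V16 registers the letter-free form 3ˢ «∃ γ₀ ε₀ ε₂₉ β′, 0 < γ₀ ∧ … ∧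
BetaLowerH 0 γ₀ β ∧ BetaUpperH β′ γ₀ β» on Cʷ — dag-n21-c Cʷ's `betaBoxW_of_sign_upper` turns 3ˢ's letters into the 3ʷ letters used below (`b := 0`, `γ := min γ₀ (min ½ (1+|β′|)⁻¹)`),
so every theorem of this file serves a 3ˢ closer by ONE application; V17 = the SIGN-FREE 3ᴬ «BetaLowerH (−β′) γ₀ β ∧ BetaUpperH β′ γ₀ β» ([I] Thm 2's «uniformly bounded») on a
later tree file: for §1∕§2 only the two history clauses matter (a clauses-keyed twin follows dag-n21-c's `_of_hcomp` provisos), while §3 READS THE SIGN of β — the coupling step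
`g_j ≤ g_{j+1}` of the (1.89) pin (12N) — which under V17 is N12's own displayed NODE O letter, not K0's).  This file instantiates this seat's GENERIC
door-cured sockets — 12T-H `…N12AtRecord13SepCoPHSockets` §2, 12V-H `…N12AtRecord13SepCoPHS` §4, 12W-H `…N12AtRecord13SepCoPHSocketsPinned` §2 — at `Θ := theta13OfNumerics F 2
(stage12NumericsOfThm1CCMW F.L 3 γ ε₀ B₃ B₃' a₀ a₁') …` (whose ₁₃ live re-pin IS `θ₁₅ᶜᶜᴹ(3;γ)` by `rfl`; K0b's residuals by K0a's `hasResidualsOfRecord_theta13OfNumerics`; admissibility by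
`admissible_theta13OfNumerics` ∘ A1ʷ `stage12NumericsOfThm1CCMW_pos_of_le_half`; term signs `κ, E₀, B₀ ≥ 0` = 12Y's at the `½`-member, same `s2` by `rfl`) with the K1-side input
`hP := §0` = dag-n21-c Bʷ `provisos₁₃SepCoP_theta13OfThm1CCMW_of_thm1GaugeR` ∘ B′ `variationalThm1GaugeRegSepCoP7MR_of_gauge9TopStepR` ∘ A2ʷ `hmono_theta13OfThm1CCMW_of_betaLowerH_half` ∕
`hcompRev_theta13OfThm1CCMW_of_betaBox_half`, fed by dag-n07-e's `variationalThm1RegSepCoP7M_of_prop8TopStep` ((8) from Prop. 8's step), dag-n21-c C's `gauge9R_cube_of_prop8TopStep_of_prop6Member`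
(the floor-carrying (9)-step at `(L³, (44+3L)L)` from Prop. 8 ∧ Prop. 6), A2's collar lemma, C's `shrunkCeiling_pos` ∕ FILE 29's `b9Of_pos`.  The witness letters `B₃' = B₉·B₃`, `a₁' = min a₁ (a₀''∕B₃)`
enter as DISPLAY EQUATIONS `hB₃'` ∕ `ha₁'` (`rfl` at the closer; `subst` here).  WHAT IT SHOWS: on the `4 ≤ F.m` branch of V16 (large-torus witness = dag-n21-c Cʷ
`exists_k0H_of_prop8TopStep_of_prop6Member_of_betaBoxW`'s `θ` = THIS door-cured parameter), the K1⁷ rung body (plan g73 v5 `stub_nodes13PWS`) at the K0⁷ witness needs from the K0 side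
NOTHING beyond V16's stub 1 ∕ stub 2 letters, stub 3ʷ's conclusion at the witness letters, and `4 ≤ F.m`; in §3 the coupling step's β-sign leaf (12N∕12P's `BetaLowerH b γ`, `γ ≤ 1`) is no longer
a separate display — it IS stub 3ʷ's lower box (A2ʷ `betaLowerH_theta13OfThm1CCMW_of_half`), and the run window `hI` is the witness's own `θ.γ = γ`.  WHICH CHILD BLOCKS (the hypothesis list,
nothing hidden): stub 1 `hB₃ ha₀ ha₁ h8` ([15] Prop. 8 p.304 — N07), stub 2 `hB₁ hc₁ hP6` ([6] Prop. 6 p.99 — N05∕N06 junction β), stub 3ʷ `hγ0 hγh hε hε' hb hβlo hβhi hletter` ([I] (1.20)–(1.22)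
p.264 on NODE O's window; sign UNPRINTED — node O), `hm : 4 ≤ F.m`; the S-bound world binding `hC hγ hL hup` (`w.γ ≤ γ`); N05 `h05S`, N06 `h06`, N07 `h07`, N08 `h08`, N09 `h09` + `h09T`, N10 `h10`,
N11 `h11` (S1ᵀ), (UV₁₃) `hUV`; N12's layer `lamW`∕`lam` with `hsel`, the mixed pin `hW ∕ hWdeg`, and N12's per-run displays BELOW THE TORUS ((1.100) pin, live-mass — NODE 00 —, Prop. 1 —
dag-n12-c ∕ 12Q⁵ —, (1.80), (1.89) — dag-n12-e's pins; in §3 12P's located per-run inputs).  The `F.m ≤ 3` families are the DECLARED RESIDUAL (stub 4; 12T-AI at the abstract inhabitant).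
Nothing of Bałaban's is asserted; every printed fact is a hypothesis; N12 is NOT discharged; no node is discharged; K0⁷ ∕ K1⁷ NOT closed; counts unmoved (discharged 5∕27 · Track A 5∕28).
ONE finite four-torus programme at fixed `ε = L^{-K}` — nothing continuum ∕ ℝ⁴ ∕ OS ∕ mass gap ∕ Clay.  No `sorry`, `def`, `instance`, `notation`.

Sources: [Balaban1989LargeFieldI] (0.2)–(0.6) p.176, Prop. 1 (1.78) p.194, (1.80) p.195, (1.89) p.198, (1.99)–(1.102) pp.200–201; [Balaban1989LargeFieldII] Thm 1 + (0.1) pp.355–356, (1.4) p.357;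
[Balaban1988Convergent] Thm 1 p.262, (2.4)–(2.13) pp.255–257, (3.16)–(3.25) pp.268–270; [Balaban1985Variational] Thm 1 (8)–(9) p.279, (144)–(152) pp.300–301, Prop. 8 p.304;
[Balaban1985RegularSpaces] (1.3)–(1.9) p.77, Prop. 6 p.99, (1.130) p.99; [Balaban1987RG1] Thm 1 p.259, (0.20)–(0.21) p.256, §1 (1.20)–(1.22) p.264.
-/

noncomputable section

open MeasureTheory
open scoped Matrix.Norms.L2Operator

namespace Summit.QuantumFields.YangMills.BalabanUVNodes.N12AtTheta13OfThm1CCMWCubeOfStubs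

open Literature.MathematicalPhysics.QuantumFieldTheory.Balaban1983to89
open Literature.MathematicalPhysics.QuantumFieldTheory.Balaban1983to89.T4Continuum (T4Family)
open Literature.MathematicalPhysics.QuantumFieldTheory.Balaban1983to89.DagBinding
open Literature.MathematicalPhysics.QuantumFieldTheory.Balaban1983to89.Node00
open FlowStep (BetaLowerH BetaUpperH)
open FlowStepRuns (genFlow)
open B15Claim189Assembly (new189 chiPP dom)
open B15 (Prop1Printed Ineq180)
open B15.BasicStep (Claim189)
open B8Eq17ClassAkV1 (plaqsOf)
open B15RPrime1100OfRep (rPrimeDataOfSel)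
open Summit.QuantumFields.YangMills.BalabanUVNodes.N12AtTheta13OfThm1CCM (kappa_nonneg_theta13OfThm1CCM E0_nonneg_theta13OfThm1CCM B0_nonneg_theta13OfThm1CCM)
open Summit.QuantumFields.YangMills.BalabanUVNodes.N12AtRecord13SepCoPHSockets (nodesAtSomeRecordS₁₃SepCoPH_of_upS_fourPinW₀_ofHistoryBlind_ofCured_liveRepin₁₃_of_massLive_of_hasResiduals)
open Summit.QuantumFields.YangMills.BalabanUVNodes.N12AtRecord13SepCoPHS (exists_guarded_recordS₁₃SepCoPH_b15_main_pinnedN12_ofHistoryBlind_ofCured_liveRepin₁₃_of_massLive_of_hasResiduals)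
open Summit.QuantumFields.YangMills.BalabanUVNodes.N12AtRecord13SepCoPHSocketsPinned (nodesAtSomeRecordS₁₃SepCoPH_of_upS_fourPinW₀_pinnedΛΩχZ_ofHistoryBlind_ofCured_liveRepin₁₃_of_massLive_of_hasResiduals)
open B15Claim189Assembly (Setting189 half)
open B15.PrelimIntegrations (Ineq191 Ineq195)
open B15Chi124DetSets (E124)
open B15DeterminingSets (MSField)
open B14DomainGeom (Pt)
open GaugeGroup (dist1)
open GaugeField (plaqHol)
open B15Claim189PrintedConditions (omegaOfChain)
open B15Claim189PinsOfHistory (sitOfHist N0OfRecord₁₃ D189OfHist)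
open B15Claim189LambdaPin (enlD)
open Summit.QuantumFields.YangMills.BalabanUVNodes.N07Thm1Top7FromProp8 (variationalThm1RegSepCoP7M_of_prop8TopStep)
open Summit.QuantumFields.YangMills.Theorems.K0ROfStepTokensRCube (shrunkCeiling_pos gauge9R_cube_of_prop8TopStep_of_prop6Member)

variable {F : T4Family}

/-! ## §0 The v1.5 provisos of record at the window-edition witness from V16's stub letters (dag-n21-c Bʷ ∘ B′ ∘ A2ʷ ∘ C ∘ dag-n07-e) -/

section Helpers
variable {B₃ B₁ : ℝ}

/-- `0 < B₃` from stub 1's inhabitation floor `2L² ≤ B₃` (`L ≥ 2`). [cite: Balaban1985Variational, Thm 1 p.279 (bookkeeping)] -/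
private theorem floor_pos (hB₃ : 2 * (F.L : ℝ) ^ 2 ≤ B₃) : 0 < B₃ :=
  lt_of_lt_of_le (mul_pos two_pos (pow_pos (by exact_mod_cast lt_trans Nat.zero_lt_one F.hL.2) 2)) hB₃

/-- `0 ≤ B₃` from the floor. [cite: Balaban1985Variational, Thm 1 p.279 (bookkeeping)] -/
private theorem floor_nonneg (hB₃ : 2 * (F.L : ℝ) ^ 2 ≤ B₃) : 0 ≤ B₃ := (floor_pos hB₃).le

/-- `0 ≤ B₉·B₃` (FILE 29's `b9Of_pos`). [cite: Balaban1985Variational, (9) p.279, (152) p.301 (bookkeeping)] -/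
private theorem b9_mul_nonneg (hB₃ : 2 * (F.L : ℝ) ^ 2 ≤ B₃) (hB₁ : 0 ≤ B₁) : 0 ≤ b9Of F (F.L ^ 3) B₁ * B₃ :=
  mul_nonneg (b9Of_pos (F := F) (F.L ^ 3) hB₁).le (floor_nonneg hB₃)

/-- The collar floor `(11·4 + 3·L)·L ≤ L³` (A2's `collar_le_M₁_theta13OfThm1CCM` at `j = 3`, read through `ν.M₁ = L³`). [cite: Balaban1985RegularSpaces, Prop. 6 p.99, (1.130) p.99 (bookkeeping)] -/
private theorem collar_le_cube (ε₀ ε₂₉ B₃ B₃' a₀ a₁' : ℝ) : (11 * 4 + 3 * F.L) * F.L ≤ F.L ^ 3 :=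
  (theta13OfThm1CCM_M₁ F 2 3 ε₀ ε₂₉ B₃ B₃' a₀ a₁') ▸ collar_le_M₁_theta13OfThm1CCM F 2 ε₀ ε₂₉ B₃ B₃' a₀ a₁' (le_refl 3)

end Helpers

section Provisos
variable {B₃ a₀ a₁ B₁ c₁ B₃' a₁' γ ε₀ ε₂₉ : ℝ}

/-- **THE v1.5 PROVISOS `Provisos₁₃SepCoP θ₁₅ᶜᶜᴹ(3;γ)` AT THE WINDOW-EDITION WITNESS FROM V16's STUB LETTERS** — dag-n21-c Bʷ `provisos₁₃SepCoP_theta13OfThm1CCMW_of_thm1GaugeR` at `(N, j) := (2, 3)`,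
`B₃' := B₉·B₃`, `a₁' := min a₁ (a₀''∕B₃)`, fed by: (8) from [15] Prop. 8's top step (dag-n07-e's bridge ∘ `.of_le`), the R gauge sentence by B′ `variationalThm1GaugeRegSepCoP7MR_of_gauge9TopStepR` at
dag-n21-c C's `gauge9R_cube_of_prop8TopStep_of_prop6Member` (Prop. 8 ∧ [6] Prop. 6 at NODE 00's member), the floor `(44+3L)L ≤ L³` (A2's collar lemma), `j + 1 ≤ F.m` := `4 ≤ F.m`, the signs (C's
`shrunkCeiling_pos`, FILE 29's `b9Of_pos`), and the two history clauses at the window edition by A2ʷ `hmono_theta13OfThm1CCMW_of_betaLowerH_half` ∕ `hcompRev_theta13OfThm1CCMW_of_betaBox_half` from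
stub 3ʷ's γ-box of `betaOfRecord₁₃ F 2 θ₁₅ᶜᶜᴹ(3)` and `β'·γ² ≤ ¾`.  Exactly the proviso term inside dag-n21-c Cʷ's ∃-closer `exists_k0H_of_prop8TopStep_of_prop6Member_of_betaBoxW`, exposed AT the
witness so that the K1-side sockets below read it.  CONDITIONAL on every displayed hypothesis; nothing of Bałaban asserted. [cite: Balaban1985Variational, (6)–(7) p.278, Thm 1 (8)–(9) p.279, (144)–(152) pp.300–301, Prop. 8 p.304; Balaban1985RegularSpaces, (1.3)–(1.9) p.77, Prop. 6 p.99, (1.130) p.99; Balaban1988Convergent, Thm 1 p.262, (2.4)–(2.8) pp.255–256, (2.12)–(2.13) pp.256–257, (3.16)–(3.22) pp.268–269; Balaban1987RG1, Thm 1 p.259, (0.20)–(0.21) p.256, (1.11)–(1.12) p.262, (1.20)–(1.22) p.264; Balaban1989LargeFieldI, (0.3)–(0.4) p.176; Balaban1989LargeFieldII, (1.4) p.357 (bookkeeping)] -/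
theorem provisos₁₃SepCoP_theta13OfThm1CCMW_cube_of_prop8TopStep_of_prop6Member_of_betaBoxW
    (hm : 4 ≤ F.m)
    -- stub 1 `stub_prop8StepCoP13`'s letters: [15] Prop. 8's top step at NODE 00's objects (N07's lane; `2L² ≤ B₃` its inhabitation floor)
    (hB₃ : 2 * (F.L : ℝ) ^ 2 ≤ B₃) (ha₀ : 0 < a₀) (ha₁ : 0 < a₁) (h8 : Prop8RegSepTopStep F 2 (fun ν K Ω => suppDomOfRecord F ν K Ω) B₃ a₀ a₁)
    -- stub 2 `stub_prop6MemberB8At13`'s letters: [6] Prop. 6 at NODE 00's ℤ⁴ cube member (N05∕N06 junction β)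
    (hB₁ : 0 ≤ B₁) (hc₁ : 0 < c₁) (hP6 : letI : CStarAlgebra (MatA 2) := {}; B8.Prop6Printed 4 (F.L : ℝ) B₁ c₁ (fun i : B8LeafModelZd.ZdIdx 4 F.L => zdCub (MatA 2) F.L i))
    -- the witness letters (dag-n21-c FILE C ∕ Cʷ): print's (9) constant `B₃' = B₉·B₃` and the shrunk ceiling `a₁' = min a₁ (a₀''∕B₃)` — two display equations, `rfl` at the closer
    (hB₃' : B₃' = b9Of F (F.L ^ 3) B₁ * B₃) (ha₁' : a₁' = min a₁ (a0Of F 2 (F.L ^ 3) B₁ c₁ / B₃))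
    -- stub 3ʷ's conclusion at these letters (dag-n21-c Cʷ `exists_k0H_of_prop8TopStep_of_prop6Member_of_betaBoxW`'s binders): the WINDOW `γ ∈ ]0, ½]`, `ε₀ ε₂₉ b β'`, the β-box ON `]0, γ]` of
    -- `betaOfRecord₁₃ F 2 θ₁₅ᶜᶜᴹ(3)` (A1's `½`-member — equal to the window edition's β on the box, A2ʷ), the letter `β'·γ² ≤ ¾` ([I] (1.22) p.264; sign UNPRINTED — node O)
    (hγ0 : 0 < γ) (hγh : γ ≤ 1 / 2) (hε : 0 < ε₀) (hε' : 0 < ε₂₉) {b β' : ℝ} (hb : 0 ≤ b) (hβlo : BetaLowerH b γ (betaOfRecord₁₃ F 2 (theta13OfThm1CCM F 2 3 ε₀ ε₂₉ B₃ B₃' a₀ a₁')))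
    (hβhi : BetaUpperH β' γ (betaOfRecord₁₃ F 2 (theta13OfThm1CCM F 2 3 ε₀ ε₂₉ B₃ B₃' a₀ a₁'))) (hletter : β' * γ ^ 2 ≤ 3 / 4) :
    (theta13OfThm1CCMW F 2 3 γ ε₀ ε₂₉ B₃ B₃' a₀ a₁').Provisos₁₃SepCoP F 2 := by
  subst hB₃' ha₁'
  exact provisos₁₃SepCoP_theta13OfThm1CCMW_of_thm1GaugeR (N := 2) (j := 3) hγ0 hγh hm hε hε' (floor_nonneg hB₃) (b9_mul_nonneg hB₃ hB₁) ha₀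
    (shrunkCeiling_pos F (F.L ^ 3) (floor_pos hB₃) hB₁ hc₁ ha₁)
    (variationalThm1RegSepCoP7M_of_prop8TopStep (floor_pos hB₃) (h8.of_le le_rfl (min_le_left _ _))) (collar_le_cube ε₀ ε₂₉ B₃ (b9Of F (F.L ^ 3) B₁ * B₃) a₀ (min a₁ (a0Of F 2 (F.L ^ 3) B₁ c₁ / B₃)))
    (variationalThm1GaugeRegSepCoP7MR_of_gauge9TopStepR (gauge9R_cube_of_prop8TopStep_of_prop6Member F (floor_pos hB₃) h8 hB₁ hc₁ hP6))
    (hmono_theta13OfThm1CCMW_of_betaLowerH_half hγh hb hβlo)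
    (hcompRev_theta13OfThm1CCMW_of_betaBox_half hγh (floor_nonneg hB₃) (b9_mul_nonneg hB₃ hB₁) ha₀.le (shrunkCeiling_pos F (F.L ^ 3) (floor_pos hB₃) hB₁ hc₁ ha₁).le hb hβlo hβhi hletter)

end Provisos

/-! ## §1 ★★★★ THE K1⁷ v5 RUNG BODY AT THE DOOR-CURED WINDOW-EDITION WITNESS FROM V16's STUB LETTERS (12T-H's cured socket ∘ §0) -/

section RungOfStubsW
variable (B₃ a₀ a₁ B₁ c₁ B₃' a₁' γ ε₀ ε₂₉ : ℝ) (lamW : ResidW F 2)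
  (Mstar : ℕ) (ops : OpsY 2 (theta13OfThm1CCMW F 2 3 γ ε₀ ε₂₉ B₃ B₃' a₀ a₁').toStage3Params Mstar) (ζ : ResidZ F 2) (W₀ : B12.RunParams → PrintedCarriers15) (w : WorldP)

/-- **★★★★ THE K0⁷ → K1⁷ JUNCTION AT THE WINDOW-EDITION WITNESS: THE v5 RUNG BODY AT THE DOOR-CURED `θ₁₅ᶜᶜᴹ(3;γ)(B₃, B₉B₃, a₀, a₁')` WITH ITS K-SIDE = V16's STUB LETTERS** (plan g77 WINDOW-WORD
l.22324: V16 = V15 with stub 3′ ↦ dag-n21-c's 3ʷ; the large-torus witness of Cʷ `exists_k0H_of_prop8TopStep_of_prop6Member_of_betaBoxW` is THIS door-cured parameter) — 12T-H's generic cured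
socket at `Θ := theta13OfNumerics … (stage12NumericsOfThm1CCMW F.L 3 γ ε₀ B₃ B₃' a₀ a₁') …` (whose ₁₃ live re-pin IS `θ₁₅ᶜᶜᴹ(3;γ)` by `rfl`) with `hP := §0`: what the K1⁷ closer of
`stub_nodes13PWS` needs from the K0 side on the `4 ≤ F.m` branch is EXACTLY stub 1's letters (`2L² ≤ B₃`, `0 < a₀`, `0 < a₁`, [15] Prop. 8's top step `h8`), stub 2's (`0 ≤ B₁`, `0 < c₁`,
[6] Prop. 6 at the member `hP6`), stub 3ʷ's CONCLUSION at the letters `(B₃, B₉·B₃, a₀, min a₁ (a₀''∕B₃))` (the window `0 < γ ≤ ½`, `ε₀ ε₂₉ b β'`, the γ-box of `betaOfRecord₁₃ F 2 θ₁₅ᶜᶜᴹ(3)`,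
`β'·γ² ≤ ¾`) and `4 ≤ F.m`.  N12 (mixed W-pin, 12E) and N13 (dag-n11-e) resolved; the S-bound world binding `hC hγ hL hup` (`w.γ ≤ θ.γ = γ`: the closer's world sits INSIDE NODE O's window),
rows h05S–h11 ∕ hUV, N12's layer `lamW` with `hsel` and its per-run displays below the torus DISPLAYED.  The conclusion IS the body of the registered `NodesAtSomeRecord13PWS F` (12T-H certificate).
COMPOSITE and CONDITIONAL: nothing of Bałaban asserted, no node discharged, K0⁷ ∕ K1⁷ NOT closed; the `F.m ≤ 3` families are the declared residual (stub 4; 12T-AI at the abstract inhabitant). [cite: Balaban1989LargeFieldII, Thm 1 p.355, (0.1) pp.355–356; Balaban1989LargeFieldI, (0.2)–(0.6) p.176, Prop. 1 (1.78) p.194, (1.80) p.195, (1.89) p.198, (1.99)–(1.102) pp.200–201; Balaban1988Convergent, Thm 1 p.262, (2.4)–(2.13) pp.255–257, (2.18) p.257, (3.16)–(3.25) pp.268–270; Balaban1985Variational, Thm 1 (8)–(9) p.279, (144)–(152) pp.300–301, Prop. 8 p.304; Balaban1985RegularSpaces, (1.3)–(1.9) p.77, Prop. 6 p.99, (1.130)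 p.99, Thm 8 (1.146) p.101; Balaban1985UV3, Thm 1 p.257, Thm 2 p.272; Balaban1985BackgroundPropagators, Thm 3.1 p.397; Balaban1987RG1, Thm 1 p.259, (0.20)–(0.21) p.256, (1.22) p.264, Lemma 4 p.280; Balaban1988RG2Cluster, Lemmas 1–3 pp.9–20 (bookkeeping)] -/
theorem nodesAtSomeRecordS₁₃SepCoPH_of_upS_fourPinW₀_ofHistoryBlind_ofCured_theta13OfThm1CCMW_cube_of_massLive_of_prop8TopStep_of_prop6Member_of_betaBoxW
    (hm : 4 ≤ F.m)
    -- stub 1 `stub_prop8StepCoP13`'s letters: [15] Prop. 8's top step at NODE 00's objects (N07's lane; `2L² ≤ B₃` its inhabitation floor)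
    (hB₃ : 2 * (F.L : ℝ) ^ 2 ≤ B₃) (ha₀ : 0 < a₀) (ha₁ : 0 < a₁) (h8 : Prop8RegSepTopStep F 2 (fun ν K Ω => suppDomOfRecord F ν K Ω) B₃ a₀ a₁)
    -- stub 2 `stub_prop6MemberB8At13`'s letters: [6] Prop. 6 at NODE 00's ℤ⁴ cube member (N05∕N06 junction β)
    (hB₁ : 0 ≤ B₁) (hc₁ : 0 < c₁) (hP6 : letI : CStarAlgebra (MatA 2) := {}; B8.Prop6Printed 4 (F.L : ℝ) B₁ c₁ (fun i : B8LeafModelZd.ZdIdx 4 F.L => zdCub (MatA 2) F.L i))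
    -- the witness letters (dag-n21-c FILE C ∕ Cʷ): print's (9) constant `B₃' = B₉·B₃` and the shrunk ceiling `a₁' = min a₁ (a₀''∕B₃)` — two display equations, `rfl` at the closer
    (hB₃' : B₃' = b9Of F (F.L ^ 3) B₁ * B₃) (ha₁' : a₁' = min a₁ (a0Of F 2 (F.L ^ 3) B₁ c₁ / B₃))
    -- stub 3ʷ's conclusion at these letters (dag-n21-c Cʷ `exists_k0H_of_prop8TopStep_of_prop6Member_of_betaBoxW`'s binders): the WINDOW `γ ∈ ]0, ½]`, `ε₀ ε₂₉ b β'`, the β-box ON `]0, γ]` of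
    -- `betaOfRecord₁₃ F 2 θ₁₅ᶜᶜᴹ(3)` (A1's `½`-member — equal to the window edition's β on the box, A2ʷ), the letter `β'·γ² ≤ ¾` ([I] (1.22) p.264; sign UNPRINTED — node O)
    (hγ0 : 0 < γ) (hγh : γ ≤ 1 / 2) (hε : 0 < ε₀) (hε' : 0 < ε₂₉) {b β' : ℝ} (hb : 0 ≤ b) (hβlo : BetaLowerH b γ (betaOfRecord₁₃ F 2 (theta13OfThm1CCM F 2 3 ε₀ ε₂₉ B₃ B₃' a₀ a₁')))
    (hβhi : BetaUpperH β' γ (betaOfRecord₁₃ F 2 (theta13OfThm1CCM F 2 3 ε₀ ε₂₉ B₃ B₃' a₀ a₁'))) (hletter : β' * γ ^ 2 ≤ 3 / 4)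
    (hW : ∀ P : B12.RunParams, lamW.kSel P < P.K → W₀ P = WOfRecord₁₃ F 2 (theta13OfThm1CCMW F 2 3 γ ε₀ ε₂₉ B₃ B₃' a₀ a₁') lamW P) (hWdeg : ∀ P : B12.RunParams, P.K ≤ lamW.kSel P → B15Leaf (W₀ P))
    (hC : w.C = (datumOfRecord₁₃SepCoPH F 2 (Stage13HParams.ofHistoryBlind F 2 (Stage13RParams.ofCured F 2 (theta13OfThm1CCMW F 2 3 γ ε₀ ε₂₉ B₃ B₃' a₀ a₁'))) (provisos₁₃SepCoP_theta13OfThm1CCMW_cube_of_prop8TopStep_of_prop6Member_of_betaBoxW hm hB₃ ha₀ ha₁ h8 hB₁ hc₁ hP6 hB₃' ha₁' hγ0 hγh hε hε' hb hβlo hβhi hletter).ofCured.ofHistoryBlind).C) (hγ : 0 < w.γ ∧ w.γ ≤ (theta13OfThm1CCMW F 2 3 γ ε₀ ε₂₉ B₃ B₃' a₀ a₁').γ) (hL : w.L = ((theta13OfThm1CCMW F 2 3 γ ε₀ ε₂₉ B₃ B₃' a₀ a₁').L : ℝ))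
    (hup : ∀ P, w.up P = upOfRecord₅CS F 2 ((((((Stage13HParams.ofHistoryBlind F 2 (Stage13RParams.ofCured F 2 (theta13OfThm1CCMW F 2 3 γ ε₀ ε₂₉ B₃ B₃' a₀ a₁'))).toStage5₁₃CoPH F 2).pinB10 F 2).pinY F 2 (Y9OfRecord 2 (theta13OfThm1CCMW F 2 3 γ ε₀ ε₂₉ B₃ B₃' a₀ a₁').toStage3Params Mstar ops)).pinZ F 2 (Z11OfRecord F 2 ζ)).pinW F 2 W₀) P)
    (h05S : ∀ P : B12.RunParams, (upOfRecord₅CS F 2 ((((((Stage13HParams.ofHistoryBlind F 2 (Stage13RParams.ofCured F 2 (theta13OfThm1CCMW F 2 3 γ ε₀ ε₂₉ B₃ B₃' a₀ a₁'))).toStage5₁₃CoPH F 2).pinB10 F 2).pinY F 2 (Y9OfRecord 2 (theta13OfThm1CCMW F 2 3 γ ε₀ ε₂₉ B₃ B₃' a₀ a₁').toStage3Params Mstar ops)).pinZ F 2 (Z11OfRecord F 2 ζ)).pinW F 2 W₀) P).b8)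
    (h06 : B9LeafX (Y9OfRecord 2 (theta13OfThm1CCMW F 2 3 γ ε₀ ε₂₉ B₃ B₃' a₀ a₁').toStage3Params Mstar ops))
    (h07 : B11Leaf (Z11OfRecord F 2 ζ))
    (h08 : PrintedUV3V 2 (theta13OfThm1CCMW F 2 3 γ ε₀ ε₂₉ B₃ B₃' a₀ a₁').L)
    (h09 : ∀ P : B12.RunParams, B12Sec2to5.Lemma4Printed ((theta13OfThm1CCMW F 2 3 γ ε₀ ε₂₉ B₃ B₃' a₀ a₁').res.X P).F12 ((theta13OfThm1CCMW F 2 3 γ ε₀ ε₂₉ B₃ B₃' a₀ a₁').res.X P).c12)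
    (h09T : ∀ P : B12.RunParams, (leavesP w P).smallCouplings → (leavesP w P).smallFieldInductive)
    (h10 : ∀ P : B12.RunParams, B9LeafX (Y9OfRecord 2 (theta13OfThm1CCMW F 2 3 γ ε₀ ε₂₉ B₃ B₃' a₀ a₁').toStage3Params Mstar ops) →
      (B10.Thm1PrintedCompact (((((((Stage13HParams.ofHistoryBlind F 2 (Stage13RParams.ofCured F 2 (theta13OfThm1CCMW F 2 3 γ ε₀ ε₂₉ B₃ B₃' a₀ a₁'))).toStage5₁₃CoPH F 2).pinB10 F 2).pinY F 2 (Y9OfRecord 2 (theta13OfThm1CCMW F 2 3 γ ε₀ ε₂₉ B₃ B₃' a₀ a₁').toStage3Params Mstar ops)).pinZ F 2 (Z11OfRecord F 2 ζ)).pinW F 2 W₀).res.X P).runs10 ∧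
          B10.Thm2Printed (((((((Stage13HParams.ofHistoryBlind F 2 (Stage13RParams.ofCured F 2 (theta13OfThm1CCMW F 2 3 γ ε₀ ε₂₉ B₃ B₃' a₀ a₁'))).toStage5₁₃CoPH F 2).pinB10 F 2).pinY F 2 (Y9OfRecord 2 (theta13OfThm1CCMW F 2 3 γ ε₀ ε₂₉ B₃ B₃' a₀ a₁').toStage3Params Mstar ops)).pinZ F 2 (Z11OfRecord F 2 ζ)).pinW F 2 W₀).res.X P).runs10) →
        B11Leaf (Z11OfRecord F 2 ζ) → B12Sec2to5.Lemma4Printed ((theta13OfThm1CCMW F 2 3 γ ε₀ ε₂₉ B₃ B₃' a₀ a₁').res.X P).F12 ((theta13OfThm1CCMW F 2 3 γ ε₀ ε₂₉ B₃ B₃' a₀ a₁').res.X P).c12 →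
          B13.Lemma1Printed ((theta13OfThm1CCMW F 2 3 γ ε₀ ε₂₉ B₃ B₃' a₀ a₁').res.X P).S13 ((theta13OfThm1CCMW F 2 3 γ ε₀ ε₂₉ B₃ B₃' a₀ a₁').res.X P).c13 ∧ B13.Lemma2Printed ((theta13OfThm1CCMW F 2 3 γ ε₀ ε₂₉ B₃ B₃' a₀ a₁').res.X P).S13 ((theta13OfThm1CCMW F 2 3 γ ε₀ ε₂₉ B₃ B₃' a₀ a₁').res.X P).c13 ∧
            B13.Lemma3Printed ((theta13OfThm1CCMW F 2 3 γ ε₀ ε₂₉ B₃ B₃' a₀ a₁').res.X P).S13 ((theta13OfThm1CCMW F 2 3 γ ε₀ ε₂₉ B₃ B₃' a₀ a₁').res.X P).c13)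
    (h11 : ∀ P : B12.RunParams, (leavesP w P).b7 → (leavesP w P).b8 → (leavesP w P).b9 → (leavesP w P).b10 → (leavesP w P).b11 →
      (leavesP w P).smallCouplings → (leavesP w P).smallFieldInductive → (leavesP w P).flowControl →
        ∀ k, k < P.K → SLaw₁₃CoPH F 2 (Stage13HParams.ofHistoryBlind F 2 (Stage13RParams.ofCured F 2 (theta13OfThm1CCMW F 2 3 γ ε₀ ε₂₉ B₃ B₃' a₀ a₁'))) P k → TLaw₁₃CoPH F 2 (Stage13HParams.ofHistoryBlind F 2 (Stage13RParams.ofCured F 2 (theta13OfThm1CCMW F 2 3 γ ε₀ ε₂₉ B₃ B₃' a₀ a₁'))) P k)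
    (hUV : ∀ P : B12.RunParams, (genFlow (betaOfRecord₁₃ F 2 (theta13OfThm1CCMW F 2 3 γ ε₀ ε₂₉ B₃ B₃' a₀ a₁')) P.g0).InInterval w.γ P.K → ∀ k, k ≤ P.K → SLaw₁₃CoPH F 2 (Stage13HParams.ofHistoryBlind F 2 (Stage13RParams.ofCured F 2 (theta13OfThm1CCMW F 2 3 γ ε₀ ε₂₉ B₃ B₃' a₀ a₁'))) P k →
      ∀ U : GaugeField (F.P P.K) k (SU 2),
        chiβOfRecord₁₃ F 2 (theta13OfThm1CCMW F 2 3 γ ε₀ ε₂₉ B₃ B₃' a₀ a₁') P.K (gOfRecord₁₃ F 2 (theta13OfThm1CCMW F 2 3 γ ε₀ ε₂₉ B₃ B₃' a₀ a₁') P) k U *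
              Real.exp (-(1 / (gOfRecord₁₃ F 2 (theta13OfThm1CCMW F 2 3 γ ε₀ ε₂₉ B₃ B₃' a₀ a₁') P k) ^ 2 * wilsonBGOfRecord F 2 (theta13OfThm1CCMW F 2 3 γ ε₀ ε₂₉ B₃ B₃' a₀ a₁').εbg P k U)
                - w.em (gOfRecord₁₃ F 2 (theta13OfThm1CCMW F 2 3 γ ε₀ ε₂₉ B₃ B₃' a₀ a₁') P k) * (Fintype.card (Site (F.P P.K) k) : ℝ)) ≤ densOfRecord₁₃ F 2 (theta13OfThm1CCMW F 2 3 γ ε₀ ε₂₉ B₃ B₃' a₀ a₁') P k U ∧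
        densOfRecord₁₃ F 2 (theta13OfThm1CCMW F 2 3 γ ε₀ ε₂₉ B₃ B₃' a₀ a₁') P k U ≤ Real.exp (w.ep (gOfRecord₁₃ F 2 (theta13OfThm1CCMW F 2 3 γ ε₀ ε₂₉ B₃ B₃' a₀ a₁') P k) * (Fintype.card (Site (F.P P.K) k) : ℝ)))
    (h12pin : ∀ P : B12.RunParams, lamW.kSel P < P.K → lamW.D1100 P
      = rPrimeDataOfSel (reprTOfRecord₁₃ F 2 (theta13OfThm1CCMW F 2 3 γ ε₀ ε₂₉ B₃ B₃' a₀ a₁') P (lamW.kSel P))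
          ((theta13OfThm1CCMW F 2 3 γ ε₀ ε₂₉ B₃ B₃' a₀ a₁').ppSel P (gOfRecord₁₃ F 2 (theta13OfThm1CCMW F 2 3 γ ε₀ ε₂₉ B₃ B₃' a₀ a₁') P) (lamW.kSel P + 1))
          (fibOfSeq F (theta13OfThm1CCMW F 2 3 γ ε₀ ε₂₉ B₃ B₃' a₀ a₁').ν (theta13OfThm1CCMW F 2 3 γ ε₀ ε₂₉ B₃ B₃' a₀ a₁').τ9 P (gOfRecord₁₃ F 2 (theta13OfThm1CCMW F 2 3 γ ε₀ ε₂₉ B₃ B₃' a₀ a₁') P) (lamW.kSel P + 1)))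
    (h12mass : ∀ P : B12.RunParams, lamW.kSel P < P.K → ∀ s, LiveSeq F 2 (theta13OfThm1CCMW F 2 3 γ ε₀ ε₂₉ B₃ B₃' a₀ a₁').ν (theta13OfThm1CCMW F 2 3 γ ε₀ ε₂₉ B₃ B₃' a₀ a₁').τ9 P (gOfRecord₁₃ F 2 (theta13OfThm1CCMW F 2 3 γ ε₀ ε₂₉ B₃ B₃' a₀ a₁') P) (lamW.kSel P + 1)
        (slotsTOfRecord F 2 (theta13OfThm1CCMW F 2 3 γ ε₀ ε₂₉ B₃ B₃' a₀ a₁').ν (theta13OfThm1CCMW F 2 3 γ ε₀ ε₂₉ B₃ B₃' a₀ a₁').τ9 (EOfRecord₁₃ F 2 (theta13OfThm1CCMW F 2 3 γ ε₀ ε₂₉ B₃ B₃' a₀ a₁')) (wOfRecord₉ F 2 (theta13OfThm1CCMW F 2 3 γ ε₀ ε₂₉ B₃ B₃' a₀ a₁').toStage9Params)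
          (theta13OfThm1CCMW F 2 3 γ ε₀ ε₂₉ B₃ B₃' a₀ a₁').ppSel P (gOfRecord₁₃ F 2 (theta13OfThm1CCMW F 2 3 γ ε₀ ε₂₉ B₃ B₃' a₀ a₁') P) (lamW.kSel P + 1)) s →
      0 < ∫ V, rterm (reprTOfRecord₁₃ F 2 (theta13OfThm1CCMW F 2 3 γ ε₀ ε₂₉ B₃ B₃' a₀ a₁') P (lamW.kSel P)) s V ∂(fieldMeasure (F.P P.K) (lamW.kSel P + 1) (SU 2)))
    (h12P1 : ∀ P : B12.RunParams, lamW.kSel P < P.K → Prop1Printed (lamW.LF P))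
    (h12i180 : ∀ P : B12.RunParams, lamW.kSel P < P.K → ∀ U, new189 (lamW.D189 P) U → ∀ i, (lamW.D189 P).h ≤ i → i ≤ (lamW.D189 P).k →
      ∀ q ∈ plaqsOf (dom (lamW.D189 P) i),
        Ineq180 ((lamW.D189 P).dev0 U q) ((lamW.D189 P).ε (lamW.D189 P).k) (lamW.D189 P).η (lamW.D189 P).B₃ (lamW.D189 P).B₅ (lamW.D189 P).M (lamW.D189 P).δ
          ((lamW.D189 P).dist q) (lamW.D189 P).O1)
    (h12c189 : ∀ P : B12.RunParams, lamW.kSel P < P.K → Claim189 (new189 (lamW.D189 P)) (chiPP (lamW.D189 P)))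
    (hsel : ∀ P : B12.RunParams, 1 ≤ P.K → lamW.kSel P < P.K) :
    ∃ (θ' : Stage13HParams F 2) (h' : θ'.Provisos₁₃SepCoPH F 2) (w : WorldP), (θ'.ZhUnity F 2 ∧ θ'.SlotsNondegenerate₁₃ F 2) ∧ θ'.Admissible F 2 ∧
      (∃ (θ'' : Stage13HParams F 2) (h'' : θ''.Provisos₁₃SepCoPH F 2), θ''.Admissible F 2 ∧
        datumOfRecord₁₃SepCoPH F 2 θ' h' = datumOfRecord₁₃SepCoPH F 2 θ'' h'' ∧ w.C = (datumOfRecord₁₃SepCoPH F 2 θ' h').C ∧ (0 < w.γ ∧ w.γ ≤ θ''.γ) ∧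
        w.L = (θ''.L : ℝ) ∧ ∀ P : B12.RunParams, w.up P = upOfRecord₅CS F 2 (θ''.toStage5₁₃CoPH F 2) P) ∧
      (∀ P : B12.RunParams, Nodes (leavesP w P)) ∧ PrintedUV3V 2 θ'.L ∧
      ∃ lam : ResidW F 2, (∀ P : B12.RunParams, 1 ≤ P.K → lam.kSel P < P.K) ∧
        ∀ P : B12.RunParams, lam.kSel P < P.K → ((leavesP w P).rBasicStep ↔ B15Leaf (WOfRecord₁₃ F 2 θ'.toStage13Params lam P)) := by
  subst hB₃' ha₁'
  exact nodesAtSomeRecordS₁₃SepCoPH_of_upS_fourPinW₀_ofHistoryBlind_ofCured_liveRepin₁₃_of_massLive_of_hasResiduals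
    (theta13OfNumerics F 2 (stage12NumericsOfThm1CCMW F.L 3 γ ε₀ B₃ (b9Of F (F.L ^ 3) B₁ * B₃) a₀ (min a₁ (a0Of F 2 (F.L ^ 3) B₁ c₁ / B₃))) ε₂₉ (zeta316OfRecord F 2 (stage12NumericsOfThm1CCMW F.L 3 γ ε₀ B₃ (b9Of F (F.L ^ 3) B₁ * B₃) a₀ (min a₁ (a0Of F 2 (F.L ^ 3) B₁ c₁ / B₃))).ν (stage12NumericsOfThm1CCMW F.L 3 γ ε₀ B₃ (b9Of F (F.L ^ 3) B₁ * B₃) a₀ (min a₁ (a0Of F 2 (F.L ^ 3) B₁ c₁ / B₃))).τ9.M (stage12NumericsOfThm1CCMW F.L 3 γ ε₀ B₃ (b9Of F (F.L ^ 3) B₁ * B₃) a₀ (min a₁ (a0Of F 2 (F.L ^ 3) B₁ c₁ / B₃))).A₁) (RzOfRecord F 2) (ZtOfRecord F 2)) lamW Mstar ops ζ W₀ w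
    (hasResidualsOfRecord_theta13OfNumerics F 2 (stage12NumericsOfThm1CCMW F.L 3 γ ε₀ B₃ (b9Of F (F.L ^ 3) B₁ * B₃) a₀ (min a₁ (a0Of F 2 (F.L ^ 3) B₁ c₁ / B₃))) ε₂₉)
    (provisos₁₃SepCoP_theta13OfThm1CCMW_cube_of_prop8TopStep_of_prop6Member_of_betaBoxW hm hB₃ ha₀ ha₁ h8 hB₁ hc₁ hP6 rfl rfl hγ0 hγh hε hε' hb hβlo hβhi hletter)
    (admissible_theta13OfNumerics F 2 (zeta316OfRecord F 2 (stage12NumericsOfThm1CCMW F.L 3 γ ε₀ B₃ (b9Of F (F.L ^ 3) B₁ * B₃) a₀ (min a₁ (a0Of F 2 (F.L ^ 3) B₁ c₁ / B₃))).ν (stage12NumericsOfThm1CCMW F.L 3 γ ε₀ B₃ (b9Of F (F.L ^ 3) B₁ * B₃) a₀ (min a₁ (a0Of F 2 (F.L ^ 3) B₁ c₁ / B₃))).τ9.M (stage12NumericsOfThm1CCMW F.L 3 γ ε₀ B₃ (b9Of F (F.L ^ 3) B₁ * B₃) a₀ (min a₁ (a0Of F 2 (F.L ^ 3) B₁ c₁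 / B₃))).A₁) (RzOfRecord F 2) (ZtOfRecord F 2) (stage12NumericsOfThm1CCMW_pos_of_le_half F.hL.2.le hγ0 hγh hε (floor_nonneg hB₃) (b9_mul_nonneg hB₃ hB₁) ha₀ (shrunkCeiling_pos F (F.L ^ 3) (floor_pos hB₃) hB₁ hc₁ ha₁)) hε')
    (kappa_nonneg_theta13OfThm1CCM F 2 3 ε₀ ε₂₉ B₃ (b9Of F (F.L ^ 3) B₁ * B₃) a₀ (min a₁ (a0Of F 2 (F.L ^ 3) B₁ c₁ / B₃))) (E0_nonneg_theta13OfThm1CCM F 2 3 ε₀ ε₂₉ B₃ (b9Of F (F.L ^ 3) B₁ * B₃) a₀ (min a₁ (a0Of F 2 (F.L ^ 3) B₁ c₁ / B₃))) (B0_nonneg_theta13OfThm1CCM F 2 3 ε₀ ε₂₉ B₃ (b9Of F (F.L ^ 3) B₁ * B₃) a₀ (min a₁ (a0Of F 2 (F.L ^ 3) B₁ c₁ / B₃)))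
    hW hWdeg hC hγ hL hup h05S h06 h07 h08 h09 h09T h10 h11 hUV h12pin h12mass h12P1 h12i180 h12c189 hsel

end RungOfStubsW

/-! ## §2 ★★★★ THE RUNG RESTRICTED TO N12, SAME INPUTS (12V-H's cured ★★ ∘ §0) -/

section N12RungOfStubsW
variable (B₃ a₀ a₁ B₁ c₁ B₃' a₁' γ ε₀ ε₂₉ : ℝ) (lamW : ResidW F 2)

/-- **★★★★ THE RUNG RESTRICTED TO N12 AT THE DOOR-CURED WINDOW-EDITION WITNESS FROM V16's STUB LETTERS** (12V-H's cured ★★ with `hP := §0`): K-side = stub 1's + stub 2's letters + stub 3ʷ's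
conclusion at `(B₃, B₉·B₃, a₀, a₁')` + `4 ≤ F.m`; N12's layer `lamW`, `hsel` and per-run displays below the torus DISPLAYED.  The N12 line of the which-child-blocks table ON V16's ROAD.  NOT the
stub; CONDITIONAL; count-neutral. [cite: Balaban1989LargeFieldII, Thm 1 p.355, (0.1) pp.355–356; Balaban1989LargeFieldI, (0.2)–(0.6) p.176, Prop. 1 (1.78) p.194, (1.80) p.195, (1.89) p.198, (1.99)–(1.102) pp.200–201; Balaban1988Convergent, (2.10)–(2.12) p.256, (2.13) p.257, (3.16)–(3.25) pp.268–270; Balaban1985Variational, Thm 1 (8)–(9) p.279, (152) p.301, Prop. 8 p.304; Balaban1985RegularSpaces, (1.3)–(1.9) p.77, Prop. 6 p.99; Balaban1987RG1, Thm 1 p.259, (0.20)–(0.21) p.256, (1.22) p.264 (bookkeeping)] -/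
theorem exists_guarded_recordS₁₃SepCoPH_b15_main_pinnedN12_ofHistoryBlind_ofCured_theta13OfThm1CCMW_cube_of_massLive_of_prop8TopStep_of_prop6Member_of_betaBoxW
    (hm : 4 ≤ F.m)
    -- stub 1 `stub_prop8StepCoP13`'s letters: [15] Prop. 8's top step at NODE 00's objects (N07's lane; `2L² ≤ B₃` its inhabitation floor)
    (hB₃ : 2 * (F.L : ℝ) ^ 2 ≤ B₃) (ha₀ : 0 < a₀) (ha₁ : 0 < a₁) (h8 : Prop8RegSepTopStep F 2 (fun ν K Ω => suppDomOfRecord F ν K Ω) B₃ a₀ a₁)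
    -- stub 2 `stub_prop6MemberB8At13`'s letters: [6] Prop. 6 at NODE 00's ℤ⁴ cube member (N05∕N06 junction β)
    (hB₁ : 0 ≤ B₁) (hc₁ : 0 < c₁) (hP6 : letI : CStarAlgebra (MatA 2) := {}; B8.Prop6Printed 4 (F.L : ℝ) B₁ c₁ (fun i : B8LeafModelZd.ZdIdx 4 F.L => zdCub (MatA 2) F.L i))
    -- the witness letters (dag-n21-c FILE C ∕ Cʷ): print's (9) constant `B₃' = B₉·B₃` and the shrunk ceiling `a₁' = min a₁ (a₀''∕B₃)` — two display equations, `rfl` at the closer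
    (hB₃' : B₃' = b9Of F (F.L ^ 3) B₁ * B₃) (ha₁' : a₁' = min a₁ (a0Of F 2 (F.L ^ 3) B₁ c₁ / B₃))
    -- stub 3ʷ's conclusion at these letters (dag-n21-c Cʷ `exists_k0H_of_prop8TopStep_of_prop6Member_of_betaBoxW`'s binders): the WINDOW `γ ∈ ]0, ½]`, `ε₀ ε₂₉ b β'`, the β-box ON `]0, γ]` of
    -- `betaOfRecord₁₃ F 2 θ₁₅ᶜᶜᴹ(3)` (A1's `½`-member — equal to the window edition's β on the box, A2ʷ), the letter `β'·γ² ≤ ¾` ([I] (1.22) p.264; sign UNPRINTED — node O)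
    (hγ0 : 0 < γ) (hγh : γ ≤ 1 / 2) (hε : 0 < ε₀) (hε' : 0 < ε₂₉) {b β' : ℝ} (hb : 0 ≤ b) (hβlo : BetaLowerH b γ (betaOfRecord₁₃ F 2 (theta13OfThm1CCM F 2 3 ε₀ ε₂₉ B₃ B₃' a₀ a₁')))
    (hβhi : BetaUpperH β' γ (betaOfRecord₁₃ F 2 (theta13OfThm1CCM F 2 3 ε₀ ε₂₉ B₃ B₃' a₀ a₁'))) (hletter : β' * γ ^ 2 ≤ 3 / 4)
    (h12pin : ∀ P : B12.RunParams, lamW.kSel P < P.K → lamW.D1100 P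
      = rPrimeDataOfSel (reprTOfRecord₁₃ F 2 (theta13OfThm1CCMW F 2 3 γ ε₀ ε₂₉ B₃ B₃' a₀ a₁') P (lamW.kSel P))
          ((theta13OfThm1CCMW F 2 3 γ ε₀ ε₂₉ B₃ B₃' a₀ a₁').ppSel P (gOfRecord₁₃ F 2 (theta13OfThm1CCMW F 2 3 γ ε₀ ε₂₉ B₃ B₃' a₀ a₁') P) (lamW.kSel P + 1))
          (fibOfSeq F (theta13OfThm1CCMW F 2 3 γ ε₀ ε₂₉ B₃ B₃' a₀ a₁').ν (theta13OfThm1CCMW F 2 3 γ ε₀ ε₂₉ B₃ B₃' a₀ a₁').τ9 P (gOfRecord₁₃ F 2 (theta13OfThm1CCMW F 2 3 γ ε₀ ε₂₉ B₃ B₃' a₀ a₁') P) (lamW.kSel P + 1)))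
    (h12mass : ∀ P : B12.RunParams, lamW.kSel P < P.K → ∀ s, LiveSeq F 2 (theta13OfThm1CCMW F 2 3 γ ε₀ ε₂₉ B₃ B₃' a₀ a₁').ν (theta13OfThm1CCMW F 2 3 γ ε₀ ε₂₉ B₃ B₃' a₀ a₁').τ9 P (gOfRecord₁₃ F 2 (theta13OfThm1CCMW F 2 3 γ ε₀ ε₂₉ B₃ B₃' a₀ a₁') P) (lamW.kSel P + 1)
        (slotsTOfRecord F 2 (theta13OfThm1CCMW F 2 3 γ ε₀ ε₂₉ B₃ B₃' a₀ a₁').ν (theta13OfThm1CCMW F 2 3 γ ε₀ ε₂₉ B₃ B₃' a₀ a₁').τ9 (EOfRecord₁₃ F 2 (theta13OfThm1CCMW F 2 3 γ ε₀ ε₂₉ B₃ B₃' a₀ a₁')) (wOfRecord₉ F 2 (theta13OfThm1CCMW F 2 3 γ ε₀ ε₂₉ B₃ B₃' a₀ a₁').toStage9Params)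
          (theta13OfThm1CCMW F 2 3 γ ε₀ ε₂₉ B₃ B₃' a₀ a₁').ppSel P (gOfRecord₁₃ F 2 (theta13OfThm1CCMW F 2 3 γ ε₀ ε₂₉ B₃ B₃' a₀ a₁') P) (lamW.kSel P + 1)) s →
      0 < ∫ V, rterm (reprTOfRecord₁₃ F 2 (theta13OfThm1CCMW F 2 3 γ ε₀ ε₂₉ B₃ B₃' a₀ a₁') P (lamW.kSel P)) s V ∂(fieldMeasure (F.P P.K) (lamW.kSel P + 1) (SU 2)))
    (h12P1 : ∀ P : B12.RunParams, lamW.kSel P < P.K → Prop1Printed (lamW.LF P))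
    (h12i180 : ∀ P : B12.RunParams, lamW.kSel P < P.K → ∀ U, new189 (lamW.D189 P) U → ∀ i, (lamW.D189 P).h ≤ i → i ≤ (lamW.D189 P).k →
      ∀ q ∈ plaqsOf (dom (lamW.D189 P) i),
        Ineq180 ((lamW.D189 P).dev0 U q) ((lamW.D189 P).ε (lamW.D189 P).k) (lamW.D189 P).η (lamW.D189 P).B₃ (lamW.D189 P).B₅ (lamW.D189 P).M (lamW.D189 P).δ
          ((lamW.D189 P).dist q) (lamW.D189 P).O1)
    (h12c189 : ∀ P : B12.RunParams, lamW.kSel P < P.K → Claim189 (new189 (lamW.D189 P)) (chiPP (lamW.D189 P)))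
    (hsel : ∀ P : B12.RunParams, 1 ≤ P.K → lamW.kSel P < P.K) :
    ∃ (θ' : Stage13HParams F 2) (h' : θ'.Provisos₁₃SepCoPH F 2) (w : WorldP), (θ'.ZhUnity F 2 ∧ θ'.SlotsNondegenerate₁₃ F 2) ∧ θ'.Admissible F 2 ∧
      (∃ (θ'' : Stage13HParams F 2) (h'' : θ''.Provisos₁₃SepCoPH F 2), θ''.Admissible F 2 ∧
        datumOfRecord₁₃SepCoPH F 2 θ' h' = datumOfRecord₁₃SepCoPH F 2 θ'' h'' ∧ w.C = (datumOfRecord₁₃SepCoPH F 2 θ' h').C ∧ (0 < w.γ ∧ w.γ ≤ θ''.γ) ∧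
        w.L = (θ''.L : ℝ) ∧ ∀ P : B12.RunParams, w.up P = upOfRecord₅CS F 2 (θ''.toStage5₁₃CoPH F 2) P) ∧
      (∀ P : B12.RunParams, Dag.B15_main (leavesP w P)) ∧
      ∃ lam : ResidW F 2, (∀ P : B12.RunParams, 1 ≤ P.K → lam.kSel P < P.K) ∧
        ∀ P : B12.RunParams, lam.kSel P < P.K → ((leavesP w P).rBasicStep ↔ B15Leaf (WOfRecord₁₃ F 2 θ'.toStage13Params lam P)) := by
  subst hB₃' ha₁'
  exact exists_guarded_recordS₁₃SepCoPH_b15_main_pinnedN12_ofHistoryBlind_ofCured_liveRepin₁₃_of_massLive_of_hasResiduals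
    (theta13OfNumerics F 2 (stage12NumericsOfThm1CCMW F.L 3 γ ε₀ B₃ (b9Of F (F.L ^ 3) B₁ * B₃) a₀ (min a₁ (a0Of F 2 (F.L ^ 3) B₁ c₁ / B₃))) ε₂₉ (zeta316OfRecord F 2 (stage12NumericsOfThm1CCMW F.L 3 γ ε₀ B₃ (b9Of F (F.L ^ 3) B₁ * B₃) a₀ (min a₁ (a0Of F 2 (F.L ^ 3) B₁ c₁ / B₃))).ν (stage12NumericsOfThm1CCMW F.L 3 γ ε₀ B₃ (b9Of F (F.L ^ 3) B₁ * B₃) a₀ (min a₁ (a0Of F 2 (F.L ^ 3) B₁ c₁ / B₃))).τ9.M (stage12NumericsOfThm1CCMW F.L 3 γ ε₀ B₃ (b9Of F (F.L ^ 3) B₁ * B₃) a₀ (min a₁ (a0Of F 2 (F.L ^ 3) B₁ c₁ / B₃))).A₁) (RzOfRecord F 2) (ZtOfRecord F 2)) lamW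
    (hasResidualsOfRecord_theta13OfNumerics F 2 (stage12NumericsOfThm1CCMW F.L 3 γ ε₀ B₃ (b9Of F (F.L ^ 3) B₁ * B₃) a₀ (min a₁ (a0Of F 2 (F.L ^ 3) B₁ c₁ / B₃))) ε₂₉)
    (provisos₁₃SepCoP_theta13OfThm1CCMW_cube_of_prop8TopStep_of_prop6Member_of_betaBoxW hm hB₃ ha₀ ha₁ h8 hB₁ hc₁ hP6 rfl rfl hγ0 hγh hε hε' hb hβlo hβhi hletter)
    (admissible_theta13OfNumerics F 2 (zeta316OfRecord F 2 (stage12NumericsOfThm1CCMW F.L 3 γ ε₀ B₃ (b9Of F (F.L ^ 3) B₁ * B₃) a₀ (min a₁ (a0Of F 2 (F.L ^ 3) B₁ c₁ / B₃))).ν (stage12NumericsOfThm1CCMW F.L 3 γ ε₀ B₃ (b9Of F (F.L ^ 3) B₁ * B₃) a₀ (min a₁ (a0Of F 2 (F.L ^ 3) B₁ c₁ / B₃))).τ9.M (stage12NumericsOfThm1CCMW F.L 3 γ ε₀ B₃ (b9Of F (F.L ^ 3) B₁ * B₃) a₀ (min a₁ (a0Of F 2 (F.L ^ 3) B₁ c₁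 / B₃))).A₁) (RzOfRecord F 2) (ZtOfRecord F 2) (stage12NumericsOfThm1CCMW_pos_of_le_half F.hL.2.le hγ0 hγh hε (floor_nonneg hB₃) (b9_mul_nonneg hB₃ hB₁) ha₀ (shrunkCeiling_pos F (F.L ^ 3) (floor_pos hB₃) hB₁ hc₁ ha₁)) hε')
    h12pin h12mass h12P1 h12i180 h12c189 hsel

end N12RungOfStubsW

/-! ## §3 ★★★★ THE ΛΩχZ-PINNED RUNG BODY AT THE DOOR-CURED WINDOW-EDITION WITNESS, SAME K-SIDE INPUTS; the coupling step's β-sign leaf IS stub 3ʷ's (12W-H's pinned socket ∘ §0) -/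

section PinnedOfStubsW
variable (B₃ a₀ a₁ B₁ c₁ B₃' a₁' γ ε₀ ε₂₉ : ℝ) (lam : ResidW F 2) (σ : ∀ P : B12.RunParams, Sit189 F 2 P.K)
  (s : ∀ P : B12.RunParams, SeqOfRecord F (theta13OfThm1CCMW F 2 3 γ ε₀ ε₂₉ B₃ B₃' a₀ a₁').ν (theta13OfThm1CCMW F 2 3 γ ε₀ ε₂₉ B₃ B₃' a₀ a₁').τ9.M (gOfRecord₁₃ F 2 (theta13OfThm1CCMW F 2 3 γ ε₀ ε₂₉ B₃ B₃' a₀ a₁') P) P.K (lam.kSel P + 1)) (Nm : B12.RunParams → ℕ) (p₁ : ℕ)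
  (Mstar : ℕ) (ops : OpsY 2 (theta13OfThm1CCMW F 2 3 γ ε₀ ε₂₉ B₃ B₃' a₀ a₁').toStage3Params Mstar) (ζ : ResidZ F 2) (W₀ : B12.RunParams → PrintedCarriers15) (w : WorldP)

/-- **★★★★ THE ΛΩχZ-PINNED RUNG BODY AT THE DOOR-CURED WINDOW-EDITION WITNESS FROM V16's STUB LETTERS** (12W-H's generic pinned socket with `hP := §0`): at `θ₁₅ᶜᶜᴹ(3;γ)(B₃, B₉B₃, a₀, a₁')` the
K1⁷ v5 rung body with N12 read at its layer of record `λᴾ` (12P's located per-run inputs) and N13 resolved needs from the K0 side EXACTLY stub 1 ∕ stub 2's letters, stub 3ʷ's conclusion at these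
letters and `4 ≤ F.m` (`0 < τ9.M = L³`, `M₂ = 1` discharged) — AND the coupling step's β-sign leaf of 12N ∕ 12P (`BetaLowerH b γ …`, `γ ≤ 1`) IS NOW stub 3ʷ's lower box read at the window edition
(A2ʷ `betaLowerH_theta13OfThm1CCMW_of_half`), its window `hI : Step.InInterval γ …` THE WITNESS's OWN `θ.γ = γ`: one letter fewer than 12Z §3.  The most complete kernel census of this seat ON V16's
road.  COMPOSITE and CONDITIONAL; nothing discharged as a node; K0⁷ ∕ K1⁷ NOT closed. [cite: Balaban1989LargeFieldII, Thm 1 p.355, (0.1) pp.355–356, p.391; Balaban1989LargeFieldI, (0.2)–(0.6) p.176, (1.2) p.178, (1.10)–(1.11) p.179, (1.73) p.192, Prop. 1 (1.78) p.194, (1.80) p.195, (1.89) p.198, (1.91)–(1.102) pp.199–201; Balaban1988Convergent, (2.1)–(2.8) pp.254–256, (2.17) p.257, (2.20)–(2.22) p.258, Thm 1 p.262, (3.16)–(3.25) pp.268–270; Balaban1987RG1, Thm 1 p.259, (0.20)–(0.21) p.256, (1.12) p.262, (1.20)–(1.22) p.264; Balaban1985RegularSpaces, (1.3)–(1.6)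 p.77, Prop. 6 p.99, Thm 8 p.101 (surviving form); Balaban1985Variational, Thm 1 (8)–(9) p.279, (152) p.301, Prop. 8 p.304 (witness letters) (bookkeeping)] -/
theorem nodesAtSomeRecordS₁₃SepCoPH_of_upS_fourPinW₀_pinnedΛΩχZ_ofHistoryBlind_ofCured_theta13OfThm1CCMW_cube_of_massLive_of_prop8TopStep_of_prop6Member_of_betaBoxW
    (hm : 4 ≤ F.m)
    -- stub 1 `stub_prop8StepCoP13`'s letters: [15] Prop. 8's top step at NODE 00's objects (N07's lane; `2L² ≤ B₃` its inhabitation floor)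
    (hB₃ : 2 * (F.L : ℝ) ^ 2 ≤ B₃) (ha₀ : 0 < a₀) (ha₁ : 0 < a₁) (h8 : Prop8RegSepTopStep F 2 (fun ν K Ω => suppDomOfRecord F ν K Ω) B₃ a₀ a₁)
    -- stub 2 `stub_prop6MemberB8At13`'s letters: [6] Prop. 6 at NODE 00's ℤ⁴ cube member (N05∕N06 junction β)
    (hB₁ : 0 ≤ B₁) (hc₁ : 0 < c₁) (hP6 : letI : CStarAlgebra (MatA 2) := {}; B8.Prop6Printed 4 (F.L : ℝ) B₁ c₁ (fun i : B8LeafModelZd.ZdIdx 4 F.L => zdCub (MatA 2) F.L i))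
    -- the witness letters (dag-n21-c FILE C ∕ Cʷ): print's (9) constant `B₃' = B₉·B₃` and the shrunk ceiling `a₁' = min a₁ (a₀''∕B₃)` — two display equations, `rfl` at the closer
    (hB₃' : B₃' = b9Of F (F.L ^ 3) B₁ * B₃) (ha₁' : a₁' = min a₁ (a0Of F 2 (F.L ^ 3) B₁ c₁ / B₃))
    -- stub 3ʷ's conclusion at these letters (dag-n21-c Cʷ `exists_k0H_of_prop8TopStep_of_prop6Member_of_betaBoxW`'s binders): the WINDOW `γ ∈ ]0, ½]`, `ε₀ ε₂₉ b β'`, the β-box ON `]0, γ]` of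
    -- `betaOfRecord₁₃ F 2 θ₁₅ᶜᶜᴹ(3)` (A1's `½`-member — equal to the window edition's β on the box, A2ʷ), the letter `β'·γ² ≤ ¾` ([I] (1.22) p.264; sign UNPRINTED — node O)
    (hγ0 : 0 < γ) (hγh : γ ≤ 1 / 2) (hε : 0 < ε₀) (hε' : 0 < ε₂₉) {b β' : ℝ} (hb : 0 ≤ b) (hβlo : BetaLowerH b γ (betaOfRecord₁₃ F 2 (theta13OfThm1CCM F 2 3 ε₀ ε₂₉ B₃ B₃' a₀ a₁')))
    (hβhi : BetaUpperH β' γ (betaOfRecord₁₃ F 2 (theta13OfThm1CCM F 2 3 ε₀ ε₂₉ B₃ B₃' a₀ a₁'))) (hletter : β' * γ ^ 2 ≤ 3 / 4)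
    -- the mixed W-pin AT THE LAYER OF RECORD λᴾ: below the torus `W₀ P` IS the bundle of record at λᴾ; elsewhere the closer's leaf-carrying `W₀ P`
    (hW : ∀ P : B12.RunParams, lam.kSel P < P.K → W₀ P = WOfRecord₁₃ F 2 (theta13OfThm1CCMW F 2 3 γ ε₀ ε₂₉ B₃ B₃' a₀ a₁')
      ((lam.pinRPrime₁₃ (theta13OfThm1CCMW F 2 3 γ ε₀ ε₂₉ B₃ B₃' a₀ a₁')).pinD189ΛH (theta13OfThm1CCMW F 2 3 γ ε₀ ε₂₉ B₃ B₃' a₀ a₁').ν (theta13OfThm1CCMW F 2 3 γ ε₀ ε₂₉ B₃ B₃' a₀ a₁').A₁ (theta13OfThm1CCMW F 2 3 γ ε₀ ε₂₉ B₃ B₃' a₀ a₁').τ9.M (gOfRecord₁₃ F 2 (theta13OfThm1CCMW F 2 3 γ ε₀ ε₂₉ B₃ B₃' a₀ a₁'))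
        (fun P => (((((σ P).pinZres (theta13OfThm1CCMW F 2 3 γ ε₀ ε₂₉ B₃ B₃' a₀ a₁').ν (theta13OfThm1CCMW F 2 3 γ ε₀ ε₂₉ B₃ B₃' a₀ a₁').τ9.M (gOfRecord₁₃ F 2 (theta13OfThm1CCMW F 2 3 γ ε₀ ε₂₉ B₃ B₃' a₀ a₁') P) (s P) (N0OfRecord₁₃ (theta13OfThm1CCMW F 2 3 γ ε₀ ε₂₉ B₃ B₃' a₀ a₁') P (lam.kSel P + 1))).pinSides (theta13OfThm1CCMW F 2 3 γ ε₀ ε₂₉ B₃ B₃' a₀ a₁').ν (gOfRecord₁₃ F 2 (theta13OfThm1CCMW F 2 3 γ ε₀ ε₂₉ B₃ B₃' a₀ a₁') P) (lam.kSel P + 1 - Nm P) (lam.kSel P + 1)).pinXΩ4 (s P) (enlD F (theta13OfThm1CCMW F 2 3 γ ε₀ ε₂₉ B₃ B₃' a₀ a₁').ν (theta13OfThm1CCMW F 2 3 γ ε₀ ε₂₉ B₃ B₃' a₀ a₁').τ9.M P (gOfRecord₁₃ F 2 (theta13OfThm1CCMW F 2 3 γ ε₀ ε₂₉ B₃ B₃'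 a₀ a₁') P))).pinOmegaPP (s P) (Nm P) (enlD F (theta13OfThm1CCMW F 2 3 γ ε₀ ε₂₉ B₃ B₃' a₀ a₁').ν (theta13OfThm1CCMW F 2 3 γ ε₀ ε₂₉ B₃ B₃' a₀ a₁').τ9.M P (gOfRecord₁₃ F 2 (theta13OfThm1CCMW F 2 3 γ ε₀ ε₂₉ B₃ B₃' a₀ a₁') P)))) s Nm p₁) P)
    (hWdeg : ∀ P : B12.RunParams, P.K ≤ lam.kSel P → B15Leaf (W₀ P))
    (hC : w.C = (datumOfRecord₁₃SepCoPH F 2 (Stage13HParams.ofHistoryBlind F 2 (Stage13RParams.ofCured F 2 (theta13OfThm1CCMW F 2 3 γ ε₀ ε₂₉ B₃ B₃' a₀ a₁'))) (provisos₁₃SepCoP_theta13OfThm1CCMW_cube_of_prop8TopStep_of_prop6Member_of_betaBoxW hm hB₃ ha₀ ha₁ h8 hB₁ hc₁ hP6 hB₃' ha₁' hγ0 hγh hε hε' hb hβlo hβhi hletter).ofCured.ofHistoryBlind).C) (hγ : 0 < w.γ ∧ w.γ ≤ (theta13OfThm1CCMW F 2 3 γ ε₀ ε₂₉ B₃ B₃'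 a₀ a₁').γ) (hL : w.L = ((theta13OfThm1CCMW F 2 3 γ ε₀ ε₂₉ B₃ B₃' a₀ a₁').L : ℝ))
    (hup : ∀ P, w.up P = upOfRecord₅CS F 2 ((((((Stage13HParams.ofHistoryBlind F 2 (Stage13RParams.ofCured F 2 (theta13OfThm1CCMW F 2 3 γ ε₀ ε₂₉ B₃ B₃' a₀ a₁'))).toStage5₁₃CoPH F 2).pinB10 F 2).pinY F 2 (Y9OfRecord 2 (theta13OfThm1CCMW F 2 3 γ ε₀ ε₂₉ B₃ B₃' a₀ a₁').toStage3Params Mstar ops)).pinZ F 2 (Z11OfRecord F 2 ζ)).pinW F 2 W₀) P)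
    (h05S : ∀ P : B12.RunParams, (upOfRecord₅CS F 2 ((((((Stage13HParams.ofHistoryBlind F 2 (Stage13RParams.ofCured F 2 (theta13OfThm1CCMW F 2 3 γ ε₀ ε₂₉ B₃ B₃' a₀ a₁'))).toStage5₁₃CoPH F 2).pinB10 F 2).pinY F 2 (Y9OfRecord 2 (theta13OfThm1CCMW F 2 3 γ ε₀ ε₂₉ B₃ B₃' a₀ a₁').toStage3Params Mstar ops)).pinZ F 2 (Z11OfRecord F 2 ζ)).pinW F 2 W₀) P).b8)
    (h06 : B9LeafX (Y9OfRecord 2 (theta13OfThm1CCMW F 2 3 γ ε₀ ε₂₉ B₃ B₃' a₀ a₁').toStage3Params Mstar ops))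
    (h07 : B11Leaf (Z11OfRecord F 2 ζ))
    (h08 : PrintedUV3V 2 (theta13OfThm1CCMW F 2 3 γ ε₀ ε₂₉ B₃ B₃' a₀ a₁').L)
    (h09 : ∀ P : B12.RunParams, B12Sec2to5.Lemma4Printed ((theta13OfThm1CCMW F 2 3 γ ε₀ ε₂₉ B₃ B₃' a₀ a₁').res.X P).F12 ((theta13OfThm1CCMW F 2 3 γ ε₀ ε₂₉ B₃ B₃' a₀ a₁').res.X P).c12)
    (h09T : ∀ P : B12.RunParams, (leavesP w P).smallCouplings → (leavesP w P).smallFieldInductive)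
    (h10 : ∀ P : B12.RunParams, B9LeafX (Y9OfRecord 2 (theta13OfThm1CCMW F 2 3 γ ε₀ ε₂₉ B₃ B₃' a₀ a₁').toStage3Params Mstar ops) →
      (B10.Thm1PrintedCompact (((((((Stage13HParams.ofHistoryBlind F 2 (Stage13RParams.ofCured F 2 (theta13OfThm1CCMW F 2 3 γ ε₀ ε₂₉ B₃ B₃' a₀ a₁'))).toStage5₁₃CoPH F 2).pinB10 F 2).pinY F 2 (Y9OfRecord 2 (theta13OfThm1CCMW F 2 3 γ ε₀ ε₂₉ B₃ B₃' a₀ a₁').toStage3Params Mstar ops)).pinZ F 2 (Z11OfRecord F 2 ζ)).pinW F 2 W₀).res.X P).runs10 ∧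
          B10.Thm2Printed (((((((Stage13HParams.ofHistoryBlind F 2 (Stage13RParams.ofCured F 2 (theta13OfThm1CCMW F 2 3 γ ε₀ ε₂₉ B₃ B₃' a₀ a₁'))).toStage5₁₃CoPH F 2).pinB10 F 2).pinY F 2 (Y9OfRecord 2 (theta13OfThm1CCMW F 2 3 γ ε₀ ε₂₉ B₃ B₃' a₀ a₁').toStage3Params Mstar ops)).pinZ F 2 (Z11OfRecord F 2 ζ)).pinW F 2 W₀).res.X P).runs10) →
        B11Leaf (Z11OfRecord F 2 ζ) → B12Sec2to5.Lemma4Printed ((theta13OfThm1CCMW F 2 3 γ ε₀ ε₂₉ B₃ B₃' a₀ a₁').res.X P).F12 ((theta13OfThm1CCMW F 2 3 γ ε₀ ε₂₉ B₃ B₃' a₀ a₁').res.X P).c12 →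
          B13.Lemma1Printed ((theta13OfThm1CCMW F 2 3 γ ε₀ ε₂₉ B₃ B₃' a₀ a₁').res.X P).S13 ((theta13OfThm1CCMW F 2 3 γ ε₀ ε₂₉ B₃ B₃' a₀ a₁').res.X P).c13 ∧ B13.Lemma2Printed ((theta13OfThm1CCMW F 2 3 γ ε₀ ε₂₉ B₃ B₃' a₀ a₁').res.X P).S13 ((theta13OfThm1CCMW F 2 3 γ ε₀ ε₂₉ B₃ B₃' a₀ a₁').res.X P).c13 ∧
            B13.Lemma3Printed ((theta13OfThm1CCMW F 2 3 γ ε₀ ε₂₉ B₃ B₃' a₀ a₁').res.X P).S13 ((theta13OfThm1CCMW F 2 3 γ ε₀ ε₂₉ B₃ B₃' a₀ a₁').res.X P).c13)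
    (h11 : ∀ P : B12.RunParams, (leavesP w P).b7 → (leavesP w P).b8 → (leavesP w P).b9 → (leavesP w P).b10 → (leavesP w P).b11 →
      (leavesP w P).smallCouplings → (leavesP w P).smallFieldInductive → (leavesP w P).flowControl →
        ∀ k, k < P.K → SLaw₁₃CoPH F 2 (Stage13HParams.ofHistoryBlind F 2 (Stage13RParams.ofCured F 2 (theta13OfThm1CCMW F 2 3 γ ε₀ ε₂₉ B₃ B₃' a₀ a₁'))) P k → TLaw₁₃CoPH F 2 (Stage13HParams.ofHistoryBlind F 2 (Stage13RParams.ofCured F 2 (theta13OfThm1CCMW F 2 3 γ ε₀ ε₂₉ B₃ B₃' a₀ a₁'))) P k)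
    (hUV : ∀ P : B12.RunParams, (genFlow (betaOfRecord₁₃ F 2 (theta13OfThm1CCMW F 2 3 γ ε₀ ε₂₉ B₃ B₃' a₀ a₁')) P.g0).InInterval w.γ P.K → ∀ k, k ≤ P.K → SLaw₁₃CoPH F 2 (Stage13HParams.ofHistoryBlind F 2 (Stage13RParams.ofCured F 2 (theta13OfThm1CCMW F 2 3 γ ε₀ ε₂₉ B₃ B₃' a₀ a₁'))) P k →
      ∀ U : GaugeField (F.P P.K) k (SU 2),
        chiβOfRecord₁₃ F 2 (theta13OfThm1CCMW F 2 3 γ ε₀ ε₂₉ B₃ B₃' a₀ a₁') P.K (gOfRecord₁₃ F 2 (theta13OfThm1CCMW F 2 3 γ ε₀ ε₂₉ B₃ B₃' a₀ a₁') P) k U *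
              Real.exp (-(1 / (gOfRecord₁₃ F 2 (theta13OfThm1CCMW F 2 3 γ ε₀ ε₂₉ B₃ B₃' a₀ a₁') P k) ^ 2 * wilsonBGOfRecord F 2 (theta13OfThm1CCMW F 2 3 γ ε₀ ε₂₉ B₃ B₃' a₀ a₁').εbg P k U)
                - w.em (gOfRecord₁₃ F 2 (theta13OfThm1CCMW F 2 3 γ ε₀ ε₂₉ B₃ B₃' a₀ a₁') P k) * (Fintype.card (Site (F.P P.K) k) : ℝ)) ≤ densOfRecord₁₃ F 2 (theta13OfThm1CCMW F 2 3 γ ε₀ ε₂₉ B₃ B₃' a₀ a₁') P k U ∧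
        densOfRecord₁₃ F 2 (theta13OfThm1CCMW F 2 3 γ ε₀ ε₂₉ B₃ B₃' a₀ a₁') P k U ≤ Real.exp (w.ep (gOfRecord₁₃ F 2 (theta13OfThm1CCMW F 2 3 γ ε₀ ε₂₉ B₃ B₃' a₀ a₁') P k) * (Fintype.card (Site (F.P P.K) k) : ℝ)))
    -- N12 AT THE LAYER OF RECORD: 12P's located per-run inputs, run by run, BELOW THE TORUS ONLY (`D P` abbreviates the pinned (1.89) setting `λᴾ.D189 P`)
    (D : ∀ P : B12.RunParams, Setting189 (F.P P.K) (SU 2) (MSField (F.P P.K) (SU 2) × ((j : ℕ) → VecField (F.P P.K) j (EuclideanSpace ℝ (Fin (2 ^ 2 - 1))))) (Pt (F.P P.K).d))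
    (hD : ∀ P : B12.RunParams, D P = ((lam.pinRPrime₁₃ (theta13OfThm1CCMW F 2 3 γ ε₀ ε₂₉ B₃ B₃' a₀ a₁')).pinD189ΛH (theta13OfThm1CCMW F 2 3 γ ε₀ ε₂₉ B₃ B₃' a₀ a₁').ν (theta13OfThm1CCMW F 2 3 γ ε₀ ε₂₉ B₃ B₃' a₀ a₁').A₁ (theta13OfThm1CCMW F 2 3 γ ε₀ ε₂₉ B₃ B₃' a₀ a₁').τ9.M (gOfRecord₁₃ F 2 (theta13OfThm1CCMW F 2 3 γ ε₀ ε₂₉ B₃ B₃' a₀ a₁')) (fun P => (((((σ P).pinZres (theta13OfThm1CCMW F 2 3 γ ε₀ ε₂₉ B₃ B₃' a₀ a₁').ν (theta13OfThm1CCMW F 2 3 γ ε₀ ε₂₉ B₃ B₃' a₀ a₁').τ9.M (gOfRecord₁₃ F 2 (theta13OfThm1CCMW F 2 3 γ ε₀ ε₂₉ B₃ B₃' a₀ a₁') P) (s P) (N0OfRecord₁₃ (theta13OfThm1CCMW F 2 3 γ ε₀ ε₂₉ B₃ B₃' a₀ a₁') P (lam.kSel P + 1))).pinSides (theta13OfThm1CCMW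 F 2 3 γ ε₀ ε₂₉ B₃ B₃' a₀ a₁').ν (gOfRecord₁₃ F 2 (theta13OfThm1CCMW F 2 3 γ ε₀ ε₂₉ B₃ B₃' a₀ a₁') P) (lam.kSel P + 1 - Nm P) (lam.kSel P + 1)).pinXΩ4 (s P) (enlD F (theta13OfThm1CCMW F 2 3 γ ε₀ ε₂₉ B₃ B₃' a₀ a₁').ν (theta13OfThm1CCMW F 2 3 γ ε₀ ε₂₉ B₃ B₃' a₀ a₁').τ9.M P (gOfRecord₁₃ F 2 (theta13OfThm1CCMW F 2 3 γ ε₀ ε₂₉ B₃ B₃' a₀ a₁') P))).pinOmegaPP (s P) (Nm P) (enlD F (theta13OfThm1CCMW F 2 3 γ ε₀ ε₂₉ B₃ B₃' a₀ a₁').ν (theta13OfThm1CCMW F 2 3 γ ε₀ ε₂₉ B₃ B₃' a₀ a₁').τ9.M P (gOfRecord₁₃ F 2 (theta13OfThm1CCMW F 2 3 γ ε₀ ε₂₉ B₃ B₃' a₀ a₁') P)))) s Nm p₁).D189 P)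
    (hmassLive : ∀ P : B12.RunParams, lam.kSel P < P.K → ∀ a, LiveSeq F 2 (theta13OfThm1CCMW F 2 3 γ ε₀ ε₂₉ B₃ B₃' a₀ a₁').ν (theta13OfThm1CCMW F 2 3 γ ε₀ ε₂₉ B₃ B₃' a₀ a₁').τ9 P (gOfRecord₁₃ F 2 (theta13OfThm1CCMW F 2 3 γ ε₀ ε₂₉ B₃ B₃' a₀ a₁') P) (lam.kSel P + 1)
        (slotsTOfRecord F 2 (theta13OfThm1CCMW F 2 3 γ ε₀ ε₂₉ B₃ B₃' a₀ a₁').ν (theta13OfThm1CCMW F 2 3 γ ε₀ ε₂₉ B₃ B₃' a₀ a₁').τ9 (EOfRecord₁₃ F 2 (theta13OfThm1CCMW F 2 3 γ ε₀ ε₂₉ B₃ B₃' a₀ a₁')) (wOfRecord₉ F 2 (theta13OfThm1CCMW F 2 3 γ ε₀ ε₂₉ B₃ B₃' a₀ a₁').toStage9Params)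
          (theta13OfThm1CCMW F 2 3 γ ε₀ ε₂₉ B₃ B₃' a₀ a₁').ppSel P (gOfRecord₁₃ F 2 (theta13OfThm1CCMW F 2 3 γ ε₀ ε₂₉ B₃ B₃' a₀ a₁') P) (lam.kSel P + 1)) a →
      0 < ∫ V, rterm (reprTOfRecord₁₃ F 2 (theta13OfThm1CCMW F 2 3 γ ε₀ ε₂₉ B₃ B₃' a₀ a₁') P (lam.kSel P)) a V ∂(fieldMeasure (F.P P.K) (lam.kSel P + 1) (SU 2)))
    (hP1 : ∀ P : B12.RunParams, lam.kSel P < P.K → Prop1Printed (lam.LF P))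
    (hlog : ∀ P : B12.RunParams, lam.kSel P < P.K → 1 < (Real.log (gOfRecord₁₃ F 2 (theta13OfThm1CCMW F 2 3 γ ε₀ ε₂₉ B₃ B₃' a₀ a₁') P (lam.kSel P + 1) ^ 2)⁻¹) ^ (theta13OfThm1CCMW F 2 3 γ ε₀ ε₂₉ B₃ B₃' a₀ a₁').ν.r)
    (hNN : ∀ P : B12.RunParams, lam.kSel P < P.K → N0OfRecord₁₃ (theta13OfThm1CCMW F 2 3 γ ε₀ ε₂₉ B₃ B₃' a₀ a₁') P (lam.kSel P + 1) ≤ Nm P)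
    (hNk : ∀ P : B12.RunParams, lam.kSel P < P.K → N0OfRecord₁₃ (theta13OfThm1CCMW F 2 3 γ ε₀ ε₂₉ B₃ B₃' a₀ a₁') P (lam.kSel P + 1) ≤ lam.kSel P + 1)
    (hβ0 : ∀ P : B12.RunParams, lam.kSel P < P.K → 0 ≤ (σ P).β)
    (hβ : ∀ P : B12.RunParams, lam.kSel P < P.K → (σ P).β ≤ 1 / 4)
    (hL₀ : ∀ P : B12.RunParams, lam.kSel P < P.K → 2 ≤ (σ P).L₀)
    (hL₀L : ∀ P : B12.RunParams, lam.kSel P < P.K → (σ P).L₀ ^ 2 ≤ ((F.P P.K).L : ℝ))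
    (hBB : ∀ P : B12.RunParams, lam.kSel P < P.K → 0 ≤ (σ P).O1 * (σ P).B₃ * (σ P).B₅)
    (hδ : ∀ P : B12.RunParams, lam.kSel P < P.K → 0 ≤ (σ P).δ)
    (hN₀ : ∀ P : B12.RunParams, lam.kSel P < P.K → (2 + (121 / 120) ^ 2 * ((σ P).O1 * (σ P).B₃ * (σ P).B₅ * ((theta13OfThm1CCMW F 2 3 γ ε₀ ε₂₉ B₃ B₃' a₀ a₁').τ9.M : ℝ) ^ 5)) *
      ((((σ P).L₀ ^ 2) ^ (N0OfRecord₁₃ (theta13OfThm1CCMW F 2 3 γ ε₀ ε₂₉ B₃ B₃' a₀ a₁') P (lam.kSel P + 1) - 1))⁻¹) ≤ 1 / 4)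
    (hMl : ∀ P : B12.RunParams, lam.kSel P < P.K → (121 / 120) ^ 2 * ((σ P).O1 * (σ P).B₃ * (σ P).B₅ * ((theta13OfThm1CCMW F 2 3 γ ε₀ ε₂₉ B₃ B₃' a₀ a₁').τ9.M : ℝ) ^ 5) * Real.exp (-(4 * (σ P).δ * ((theta13OfThm1CCMW F 2 3 γ ε₀ ε₂₉ B₃ B₃' a₀ a₁').τ9.M : ℝ))) ≤ 1 / 12)
    (hε0 : ∀ P : B12.RunParams, lam.kSel P < P.K → ∀ i, lam.kSel P + 1 - Nm P ≤ i → i ≤ lam.kSel P + 1 → 0 ≤ epsOfRecord (theta13OfThm1CCMW F 2 3 γ ε₀ ε₂₉ B₃ B₃' a₀ a₁').ν (gOfRecord₁₃ F 2 (theta13OfThm1CCMW F 2 3 γ ε₀ ε₂₉ B₃ B₃' a₀ a₁') P) i)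
    (hε1 : ∀ P : B12.RunParams, lam.kSel P < P.K → ∀ i, lam.kSel P + 1 - Nm P ≤ i → i ≤ lam.kSel P + 1 → epsOfRecord (theta13OfThm1CCMW F 2 3 γ ε₀ ε₂₉ B₃ B₃' a₀ a₁').ν (gOfRecord₁₃ F 2 (theta13OfThm1CCMW F 2 3 γ ε₀ ε₂₉ B₃ B₃' a₀ a₁') P) i ≤ 1 / 10)
    {β₀ : ℝ}
    (hβ₀0 : 0 ≤ β₀)
    (hβ₀ : β₀ ≤ 1 / 2)
    (hflow : ∀ P : B12.RunParams, lam.kSel P < P.K → ∀ j, lam.kSel P + 1 - Nm P ≤ j → j < lam.kSel P + 1 → epsOfRecord (theta13OfThm1CCMW F 2 3 γ ε₀ ε₂₉ B₃ B₃' a₀ a₁').ν (gOfRecord₁₃ F 2 (theta13OfThm1CCMW F 2 3 γ ε₀ ε₂₉ B₃ B₃' a₀ a₁') P) (lam.kSel P + 1)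
      ≤ (1 + β₀) * Real.sqrt ((lam.kSel P + 1 - j : ℕ) : ℝ) * epsOfRecord (theta13OfThm1CCMW F 2 3 γ ε₀ ε₂₉ B₃ B₃' a₀ a₁').ν (gOfRecord₁₃ F 2 (theta13OfThm1CCMW F 2 3 γ ε₀ ε₂₉ B₃ B₃' a₀ a₁') P) j)
    (hI : ∀ P : B12.RunParams, lam.kSel P < P.K → Step.InInterval γ P.K (gOfRecord₁₃ F 2 (theta13OfThm1CCMW F 2 3 γ ε₀ ε₂₉ B₃ B₃' a₀ a₁') P))
    (hΛ : ∀ P : B12.RunParams, lam.kSel P < P.K → (((enlD F (theta13OfThm1CCMW F 2 3 γ ε₀ ε₂₉ B₃ B₃' a₀ a₁').ν (theta13OfThm1CCMW F 2 3 γ ε₀ ε₂₉ B₃ B₃' a₀ a₁').τ9.M P (gOfRecord₁₃ F 2 (theta13OfThm1CCMW F 2 3 γ ε₀ ε₂₉ B₃ B₃' a₀ a₁') P)) 4 (lam.kSel P + 1 + 1 - (N0OfRecord₁₃ (theta13OfThm1CCMW F 2 3 γ ε₀ ε₂₉ B₃ B₃' a₀ a₁') P (lam.kSel P + 1)))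
        (omegaOfChain (s P) (lam.kSel P + 1 + 1 - (N0OfRecord₁₃ (theta13OfThm1CCMW F 2 3 γ ε₀ ε₂₉ B₃ B₃' a₀ a₁') P (lam.kSel P + 1)))))ᶜ ∩ (σ P).Z).Nonempty)
    (L91h : ∀ P : B12.RunParams, lam.kSel P < P.K → ∀ U, new189 (D P) U → ∀ p ∈ plaqsOf (half (D P)),
      Ineq191 (dist1 (plaqHol ((D P).Upp U) p)) ((D P).devV'' U p) (D P).α (((D P).L ^ (D P).h)⁻¹) ((D P).ε (D P).h) (E124 (D P).ε (D P).L (D P).η (D P).k (D P).h))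
    (L95 : ∀ P : B12.RunParams, lam.kSel P < P.K → ∀ U, new189 (D P) U → ∀ p ∈ plaqsOf (half (D P)),
      Ineq195 ((D P).devV'' U p) (dist1 (plaqHol ((D P).Uhalf U ((D P).boxOf p)) p)) (D P).α (((D P).L ^ (D P).h)⁻¹) ((D P).ε (D P).h) (E124 (D P).ε (D P).L (D P).η (D P).k (D P).h))
    (L91 : ∀ P : B12.RunParams, lam.kSel P < P.K → ∀ U, new189 (D P) U → ∀ j, (D P).h ≤ j → j ≤ (D P).k → ∀ p ∈ plaqsOf (dom (D P) j),
      Ineq191 (dist1 (plaqHol ((D P).Upp U) p)) ((D P).dev97 U p) (D P).α (((D P).L ^ j)⁻¹) ((D P).ε j) (E124 (D P).ε (D P).L (D P).η (D P).k j))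
    (L97 : ∀ P : B12.RunParams, lam.kSel P < P.K → ∀ U, new189 (D P) U → ∀ j, (D P).h ≤ j → j ≤ (D P).k → ∀ p ∈ plaqsOf (dom (D P) j),
      Ineq191 ((D P).dev97 U p) ((D P).dev0 U p) (D P).α (((D P).L ^ j)⁻¹) ((D P).ε j) (E124 (D P).ε (D P).L (D P).η (D P).k j))
    (L80 : ∀ P : B12.RunParams, lam.kSel P < P.K → ∀ U, new189 (D P) U → ∀ j, (D P).h ≤ j → j ≤ (D P).k → ∀ p ∈ plaqsOf (dom (D P) j),
      Ineq180 ((D P).dev0 U p) ((D P).ε (D P).k) (D P).η (D P).B₃ (D P).B₅ (D P).M (D P).δ ((D P).dist p) (D P).O1)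
    (hsel : ∀ P : B12.RunParams, 1 ≤ P.K → lam.kSel P < P.K) :
    ∃ (θ' : Stage13HParams F 2) (h' : θ'.Provisos₁₃SepCoPH F 2) (w : WorldP), (θ'.ZhUnity F 2 ∧ θ'.SlotsNondegenerate₁₃ F 2) ∧ θ'.Admissible F 2 ∧
      (∃ (θ'' : Stage13HParams F 2) (h'' : θ''.Provisos₁₃SepCoPH F 2), θ''.Admissible F 2 ∧
        datumOfRecord₁₃SepCoPH F 2 θ' h' = datumOfRecord₁₃SepCoPH F 2 θ'' h'' ∧ w.C = (datumOfRecord₁₃SepCoPH F 2 θ' h').C ∧ (0 < w.γ ∧ w.γ ≤ θ''.γ) ∧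
        w.L = (θ''.L : ℝ) ∧ ∀ P : B12.RunParams, w.up P = upOfRecord₅CS F 2 (θ''.toStage5₁₃CoPH F 2) P) ∧
      (∀ P : B12.RunParams, Nodes (leavesP w P)) ∧ PrintedUV3V 2 θ'.L ∧
      ∃ lam : ResidW F 2, (∀ P : B12.RunParams, 1 ≤ P.K → lam.kSel P < P.K) ∧
        ∀ P : B12.RunParams, lam.kSel P < P.K → ((leavesP w P).rBasicStep ↔ B15Leaf (WOfRecord₁₃ F 2 θ'.toStage13Params lam P)) := by
  subst hB₃' ha₁'
  exact nodesAtSomeRecordS₁₃SepCoPH_of_upS_fourPinW₀_pinnedΛΩχZ_ofHistoryBlind_ofCured_liveRepin₁₃_of_massLive_of_hasResiduals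
    (theta13OfNumerics F 2 (stage12NumericsOfThm1CCMW F.L 3 γ ε₀ B₃ (b9Of F (F.L ^ 3) B₁ * B₃) a₀ (min a₁ (a0Of F 2 (F.L ^ 3) B₁ c₁ / B₃))) ε₂₉ (zeta316OfRecord F 2 (stage12NumericsOfThm1CCMW F.L 3 γ ε₀ B₃ (b9Of F (F.L ^ 3) B₁ * B₃) a₀ (min a₁ (a0Of F 2 (F.L ^ 3) B₁ c₁ / B₃))).ν (stage12NumericsOfThm1CCMW F.L 3 γ ε₀ B₃ (b9Of F (F.L ^ 3) B₁ * B₃) a₀ (min a₁ (a0Of F 2 (F.L ^ 3) B₁ c₁ / B₃))).τ9.M (stage12NumericsOfThm1CCMW F.L 3 γ ε₀ B₃ (b9Of F (F.L ^ 3) B₁ * B₃) a₀ (min a₁ (a0Of F 2 (F.L ^ 3) B₁ c₁ / B₃))).A₁) (RzOfRecord F 2) (ZtOfRecord F 2)) lam σ s Nm p₁ Mstar ops ζ W₀ w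
    (hasResidualsOfRecord_theta13OfNumerics F 2 (stage12NumericsOfThm1CCMW F.L 3 γ ε₀ B₃ (b9Of F (F.L ^ 3) B₁ * B₃) a₀ (min a₁ (a0Of F 2 (F.L ^ 3) B₁ c₁ / B₃))) ε₂₉)
    (provisos₁₃SepCoP_theta13OfThm1CCMW_cube_of_prop8TopStep_of_prop6Member_of_betaBoxW hm hB₃ ha₀ ha₁ h8 hB₁ hc₁ hP6 rfl rfl hγ0 hγh hε hε' hb hβlo hβhi hletter)
    (admissible_theta13OfNumerics F 2 (zeta316OfRecord F 2 (stage12NumericsOfThm1CCMW F.L 3 γ ε₀ B₃ (b9Of F (F.L ^ 3) B₁ * B₃) a₀ (min a₁ (a0Of F 2 (F.L ^ 3) B₁ c₁ / B₃))).ν (stage12NumericsOfThm1CCMW F.L 3 γ ε₀ B₃ (b9Of F (F.L ^ 3) B₁ * B₃) a₀ (min a₁ (a0Of F 2 (F.L ^ 3) B₁ c₁ / B₃))).τ9.M (stage12NumericsOfThm1CCMW F.L 3 γ ε₀ B₃ (b9Of F (F.L ^ 3) B₁ * B₃) a₀ (min a₁ (a0Of F 2 (F.L ^ 3) B₁ c₁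 / B₃))).A₁) (RzOfRecord F 2) (ZtOfRecord F 2) (stage12NumericsOfThm1CCMW_pos_of_le_half F.hL.2.le hγ0 hγh hε (floor_nonneg hB₃) (b9_mul_nonneg hB₃ hB₁) ha₀ (shrunkCeiling_pos F (F.L ^ 3) (floor_pos hB₃) hB₁ hc₁ ha₁)) hε')
    (kappa_nonneg_theta13OfThm1CCM F 2 3 ε₀ ε₂₉ B₃ (b9Of F (F.L ^ 3) B₁ * B₃) a₀ (min a₁ (a0Of F 2 (F.L ^ 3) B₁ c₁ / B₃))) (E0_nonneg_theta13OfThm1CCM F 2 3 ε₀ ε₂₉ B₃ (b9Of F (F.L ^ 3) B₁ * B₃) a₀ (min a₁ (a0Of F 2 (F.L ^ 3) B₁ c₁ / B₃))) (B0_nonneg_theta13OfThm1CCM F 2 3 ε₀ ε₂₉ B₃ (b9Of F (F.L ^ 3) B₁ * B₃) a₀ (min a₁ (a0Of F 2 (F.L ^ 3) B₁ c₁ / B₃)))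
    hW hWdeg hC hγ hL hup h05S h06 h07 h08 h09 h09T h10 h11 hUV
    Nat.one_pos -- `M₂ = 1` at the collared member (`rfl`)
    (pow_pos (Nat.zero_lt_of_lt F.hL.2) 3) -- `M = L³ > 0`
    D hD hmassLive hP1 hlog hNN hNk hβ0 hβ hL₀ hL₀L hBB hδ hN₀ hMl hε0 hε1 hβ₀0 hβ₀ hflow
    hb (betaLowerH_theta13OfThm1CCMW_of_half hγh hβlo) (hγh.trans (by norm_num)) -- the β-sign leaf of the coupling step IS stub 3ʷ's lower box, its window the witness's
    hI hΛ L91h L95 L91 L97 L80 hsel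

end PinnedOfStubsW

end Summit.QuantumFields.YangMills.BalabanUVNodes.N12AtTheta13OfThm1CCMWCubeOfStubs
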